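import Mathlib
import Literature.Computability.Complexity.CNF
import Summits.PneNP.PneNP.Theorems.OverlapGapAlgebraSolvableImpliesStableSectionMeanSquareTransfer
import Summits.PneNP.PneNP.Theorems.OverlapGapAlgebraSearchHardWindowSequentialLocalRung

/-!
# PneNP / OverlapGapAlgebra — crux `SolvableImpliesStableSection` (stmt-PneNP-2463):
# the transfer HOLDS for sequential local solvers (index-order decimation, unit look-ahead)

Support for crux `stmt-PneNP-2463` (`Summit.PneNP.PneNP.Theses.OverlapGapAlgebra.SolvableImpliesStableSection`:
"solvable in polynomial time with probability `≥ ε` ⇒ for all `η, ν, c > 0`, infinitely often an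
`ηn`-stable, `νm`-valid section exists on `≥ e^{-cn}` of the Bresler–Huang path tuples").

An INDEX-ORDER DECIMATION RULE WITH UNIT LOOK-AHEAD (hypothesis `hseq`, definition-free: the bit
at `v` is any label-dependent function of the labelled clauses containing `v` and of the rule's own
bits at the smaller variables in them — Unit-Clause-type rules in a fixed order, one-round
message-passing-guided decimation, the radius-one sequential local algorithms of Gamarnik–Sudan)
has CONSTANT mean-square single-literal sensitivity `S(k, α) = (k+1)²(1+αk²)e^{αk²(1+k²+αk²)}`
(`shwSeq_meanSquare`: light cones along increasing chains + the bounded second moment of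
increasing cones). Hence the mean-square transfer applies at EVERY density:

* `sissSeq_concl_of_seqLocalSolver` — for every `k ≥ 1`, `α, η, ν, ε > 0`: if infinitely often
  some index-order decimation rule with unit look-ahead solves an `ε`-fraction of
  `F_k(n, ⌊αn⌋)`, the conclusion of the crux holds for every `c > 0` (the rule itself is the
  section);
* `sissSeq_solvableImpliesStableSection_of_seqLocal` — the crux VERBATIM with `IsPolyTime f`
  REPLACED by "eventually in `n` the decoded section of `f` is such a rule" (no complexity
  hypothesis): `SolvableImpliesStableSection` is a THEOREM on the class of sequential local
  solvers — the first adaptive class (unbounded radius, `n` dependent rounds) for which it is.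
No definitions; axioms `propext`, `Classical.choice`, `Quot.sound`.
-/

set_option linter.dupNamespace false -- `Summit.PneNP.PneNP.…`: summit = sub-problem (D-0017)

namespace Summit.PneNP.PneNP.Theorems

open Finset Filter Asymptotics
open scoped Classical

/-- **Sequential local solvers give stable sections.** For every `k ≥ 1`, `α, η, ν, ε > 0`: if,
for infinitely many `n` (`m = ⌊αn⌋₊`), some index-order decimation rule with unit look-ahead
solves at least an `ε`-fraction of `F_k(n, m)`, then for every `c > 0`, infinitely often, some map
is `νm`-valid at every splice point of the Bresler–Huang path and `ηn`-stable between consecutive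
ones on at least `e^{-cn}·#paths` of the path tuples — the conclusion of
`SolvableImpliesStableSection` at `(k, α, η, ν)`. -/
theorem sissSeq_concl_of_seqLocalSolver (k : ℕ) (hk : 1 ≤ k) (α η ν : ℝ) (hα : 0 < α)
    (hη : 0 < η) (hν : 0 < ν) (ε : ℝ) (hε : 0 < ε)
    (hsolv : ∃ᶠ n : ℕ in atTop, ∀ m : ℕ, m = ⌊α * n⌋₊ →
      ∃ g : (Fin m → Fin k → Fin n × Bool) → (Fin n → Bool), (∀ (Φ Φ' : (Fin m → Fin k → Fin n × Bool)) (v : Fin n),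
        (∀ i : Fin m, ((∃ j : Fin k, (Φ i j).1 = v) ∨ (∃ j : Fin k, (Φ' i j).1 = v)) → Φ i = Φ' i) →
        (∀ (i : Fin m) (j j' : Fin k), (Φ i j).1 = v → (Φ i j').1 < v →
          g Φ (Φ i j').1 = g Φ' (Φ i j').1) →
        g Φ v = g Φ' v) ∧
        ε * Fintype.card (Fin m → Fin k → Fin n × Bool) ≤
          ((Finset.univ.filter fun Φ : Fin m → Fin k → Fin n × Bool =>
            ∀ i, ∃ j, g Φ (Φ i j).1 = (Φ i j).2).card : ℝ))
    (c : ℝ) (hc : 0 < c) :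
    ∃ᶠ n : ℕ in atTop, ∀ m : ℕ, m = ⌊α * n⌋₊ →
      ∃ g : (Fin m → Fin k → Fin n × Bool) → (Fin n → Bool),
        Real.exp (-(c * n)) * Fintype.card (Fin (k + 1) → Fin m → Fin k → Fin n × Bool) ≤
        ((Finset.univ.filter fun Ψ : Fin (k + 1) → Fin m → Fin k → Fin n × Bool =>
          let P : Fin k → ℕ → Fin m → Fin k → Fin n × Bool :=
            fun r q a b => if (a : ℕ) * k + b < q then Ψ r.succ a b else Ψ r.castSucc a b
          (∀ r : Fin k, ∀ q ≤ m * k, ((Finset.univ.filter fun i : Fin m =>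
            ∀ j, g (P r q) (P r q i j).1 ≠ (P r q i j).2).card : ℝ) ≤ ν * m) ∧
          ∀ r : Fin k, ∀ q < m * k,
            (hammingDist (g (P r q)) (g (P r (q + 1))) : ℝ) ≤ η * n).card : ℝ) := by
  set β : ℝ := α * (k : ℝ) ^ 2 with hβdef
  set S : ℝ := ((k : ℝ) + 1) ^ 2 * ((1 + β) * Real.exp (β * (1 + (k : ℝ) ^ 2 + β))) with hSdef
  refine sissMS_concl_of_meanSquareStableSolver k hk α η ν hα hη hν (fun _ : ℕ => S)
    (shwSeq_isLittleO S) ε hε ?_ c hc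
  refine (hsolv.and_eventually (eventually_ge_atTop 1)).mono ?_
  rintro n ⟨hn, hn1⟩ m hm
  obtain ⟨g, hseq, hsucc⟩ := hn m hm
  have hm_le : (m : ℝ) ≤ α * n := by rw [hm]; exact Nat.floor_le (by positivity)
  have hβn : (m : ℝ) * (k : ℝ) ^ 2 ≤ β * n := by
    rw [hβdef]
    have hk2 : (0 : ℝ) ≤ (k : ℝ) ^ 2 := by positivity
    nlinarith [mul_le_mul_of_nonneg_right hm_le hk2]
  exact ⟨g, shwSeq_meanSquare hn1 β hβn g hseq, hsucc⟩

/-- **`SolvableImpliesStableSection` HOLDS on the class of sequential local solvers.** For every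
`k ≥ 1` and `α, η, ν > 0`: the crux `SolvableImpliesStableSection` verbatim, with its hypothesis
`IsPolyTime f` REPLACED by "eventually in `n`, the decoded section `Φ ↦ (v ↦ (f ⌜Φ⌝).getD v false)`
of `f` on `F_k(n, ⌊αn⌋₊)` is an index-order decimation rule with unit look-ahead" (no complexity
hypothesis, every density). What the crux asserts beyond it is the transfer for polynomial-time
solvers whose sections are not of this (or any other ℓ²-stable) kind. -/
theorem sissSeq_solvableImpliesStableSection_of_seqLocal (k : ℕ) (hk : 1 ≤ k) (α η ν : ℝ)
    (hα : 0 < α) (hη : 0 < η) (hν : 0 < ν)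
    (hsolv : ∃ f : List Bool → List Bool,
      (∀ᶠ n : ℕ in atTop, ∀ m : ℕ, m = ⌊α * n⌋₊ → (∀ (Φ Φ' : (Fin m → Fin k → Fin n × Bool)) (v : Fin n),
        (∀ i : Fin m, ((∃ j : Fin k, (Φ i j).1 = v) ∨ (∃ j : Fin k, (Φ' i j).1 = v)) → Φ i = Φ' i) →
        (∀ (i : Fin m) (j j' : Fin k), (Φ i j).1 = v → (Φ i j').1 < v →
          (f (Literature.Computability.Complexity.encodingCNF.encode (List.ofFn fun a =>
            List.ofFn fun b => (((Φ a b).1 : ℕ), (Φ a b).2)))).getD (Φ i j').1 false =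
          (f (Literature.Computability.Complexity.encodingCNF.encode (List.ofFn fun a =>
            List.ofFn fun b => (((Φ' a b).1 : ℕ), (Φ' a b).2)))).getD (Φ i j').1 false) →
        (f (Literature.Computability.Complexity.encodingCNF.encode (List.ofFn fun a =>
            List.ofFn fun b => (((Φ a b).1 : ℕ), (Φ a b).2)))).getD v false =
        (f (Literature.Computability.Complexity.encodingCNF.encode (List.ofFn fun a =>
            List.ofFn fun b => (((Φ' a b).1 : ℕ), (Φ' a b).2)))).getD v false)) ∧
      ∃ ε : ℝ, 0 < ε ∧ ∃ᶠ n : ℕ in Filter.atTop, ∀ m : ℕ, m = ⌊α * n⌋₊ → ε ≤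
        ((Finset.univ.filter fun Φ : Fin m → Fin k → Fin n × Bool => ∀ i, ∃ j,
          (f (Literature.Computability.Complexity.encodingCNF.encode (List.ofFn fun a =>
            List.ofFn fun b => (((Φ a b).1 : ℕ), (Φ a b).2)))).getD (Φ i j).1 false =
              (Φ i j).2).card : ℝ) / Fintype.card (Fin m → Fin k → Fin n × Bool))
    (c : ℝ) (hc : 0 < c) :
    ∃ᶠ n : ℕ in Filter.atTop, ∀ m : ℕ, m = ⌊α * n⌋₊ →
      ∃ g : (Fin m → Fin k → Fin n × Bool) → (Fin n → Bool),
        Real.exp (-(c * n)) * Fintype.card (Fin (k + 1) → Fin m → Fin k → Fin n × Bool) ≤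
        ((Finset.univ.filter fun Ψ : Fin (k + 1) → Fin m → Fin k → Fin n × Bool =>
          let P : Fin k → ℕ → Fin m → Fin k → Fin n × Bool :=
            fun r q a b => if (a : ℕ) * k + b < q then Ψ r.succ a b else Ψ r.castSucc a b
          (∀ r : Fin k, ∀ q ≤ m * k, ((Finset.univ.filter fun i : Fin m =>
            ∀ j, g (P r q) (P r q i j).1 ≠ (P r q i j).2).card : ℝ) ≤ ν * m) ∧
          ∀ r : Fin k, ∀ q < m * k,
            (hammingDist (g (P r q)) (g (P r (q + 1))) : ℝ) ≤ η * n).card : ℝ) := by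
  obtain ⟨f, hSEQ, ε, hε, hfreq⟩ := hsolv
  refine sissSeq_concl_of_seqLocalSolver k hk α η ν hα hη hν ε hε ?_ c hc
  refine (hfreq.and_eventually (hSEQ.and (eventually_ge_atTop 1))).mono ?_
  rintro n ⟨hn, hSEQn, hn1⟩ m hm
  refine ⟨fun Φ v => (f (Literature.Computability.Complexity.encodingCNF.encode (List.ofFn fun a =>
            List.ofFn fun b => (((Φ a b).1 : ℕ), (Φ a b).2)))).getD v false, hSEQn m hm, ?_⟩
  have h := hn m hm
  haveI : Nonempty (Fin n × Bool) := ⟨(⟨0, hn1⟩, false)⟩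
  have hN : (0 : ℝ) < Fintype.card (Fin m → Fin k → Fin n × Bool) := by
    exact_mod_cast Fintype.card_pos
  rw [le_div_iff₀ hN] at h
  exact h

end Summit.PneNP.PneNP.Theorems
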